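import Literature.AlgebraicGeometry.HodgeTheory.QuaternionicQuarticDeckChartInCover
import Literature.AlgebraicGeometry.HodgeTheory.QuaternionicQuarticDeckChartBaseChange
import Literature.AlgebraicGeometry.HodgeTheory.QuaternionicQuarticCoverGeneric
import HarnessLib

/-!
# The deck chart over a point `A → L` is an open piece of the fibre `𝒱_φ` of the cover (M1-1, fibrewise form)

Layer `Literature/AlgebraicGeometry/HodgeTheory`. Theorems only; no named fact. Written by the prover seat
`hodge-nonav-19716-p2` (g13, cell `hodge-nonav`) as the FIBREWISE corollary of brick M1-1 «CHART-IN-COVER»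
(`QuaternionicQuarticDeckChartInCover.exists_chartEmb`) requested by p3 g36 (2026-08-29T11:49:20Z) for prover-Bx's
`Q8FamilyDeck_birational` / stub S7 of crux K1Q (route `HodgeConjecture/Q8SymplecticPowers`, stmt-HodgeConjecture-24190):
base-changing the open immersion `Spec (DeckRing X) ↪ cover e` over `Spec A` along an `A`-algebra `L` gives an open immersion
of `Spec (DeckRing X) ×_A Spec L = Spec (DeckRing X_L)` (prover-Bx, `deckChartTensorLeftIso`) into the fibre
`𝒱 ×_A Spec L = fiberSch e (algebraMap A L)`, over `Spec L`, with image `fiberEmb⁻¹ D₊(x₂·H̃_L)`.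

* `isPullback_baseChange_map_left'` — for ANY commutative `k → L` and a `k`-morphism `i : X ⟶ Y`, the square
  `X_L ⟶ Y_L`, `X_L ⟶ X`, `Y_L ⟶ Y`, `i` is cartesian (the tree's `isPullback_baseChange_map_left` for fields, same proof);
* `map_branchForm` — `H̃` is natural in the coefficients;
* **`exists_chartEmb_baseChange`** — the open immersion `(deckChart X ⊗ specOver A L).left ⟶ (fiberSch e (algebraMap A L)).left`
  over `Spec L` with image `fiberEmb⁻¹ D₊(x₂·H̃_L)`; **`exists_chartEmb_fibre`** — the same with source `Spec (DeckRing X_L)`.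

Honest scope: base-change bookkeeping; nothing here bears on HC.

## References

* [Liu2002] Q. Liu, Algebraic Geometry and Arithmetic Curves (2002), Rem. 3.1.20, Prop. 3.1.9.
* [Hartshorne1977] R. Hartshorne, Algebraic Geometry (1977), II Ex. 3.11 (a), II Example 3.2.6.
-/

noncomputable section

set_option backward.isDefEq.respectTransparency false

open CategoryTheory CategoryTheory.Limits AlgebraicGeometry MvPolynomial HomogeneousLocalization TopologicalSpace MonoidalCategory
open Literature.AlgebraicGeometry.Motives Literature.AlgebraicGeometry.Motives.UniversalHypersurface

namespace Literature.AlgebraicGeometry.HodgeTheory.Q8Family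

attribute [local instance] MvPolynomial.gradedAlgebra

section BaseChangeSquare

universe u

/-- For a `k`-morphism `i : X ⟶ Y` over ANY commutative ring map `k → L`, the square `X_L ⟶ Y_L`, `X_L ⟶ X`, `Y_L ⟶ Y`, `i`
is cartesian (`X ×_S S' = X ×_Y (Y ×_S S')`). [cite: Liu2002, Rem. 3.1.20] -/
theorem isPullback_baseChange_map_left' {k L : Type u} [CommRing k] [CommRing L] [Algebra k L] {X Y : SchemeOver k}
    (i : X ⟶ Y) :
    IsPullback ((Literature.AlgebraicGeometry.Motives.baseChange k L).map i).left
      (pullback.fst X.hom (Spec.map (CommRingCat.ofHom (algebraMap k L))))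
      (pullback.fst Y.hom (Spec.map (CommRingCat.ofHom (algebraMap k L)))) i.left := by
  refine IsPullback.of_right ?_ (pullback.lift_fst _ _ _)
    (IsPullback.of_hasPullback Y.hom (Spec.map (CommRingCat.ofHom (algebraMap k L)))).flip
  have h1 : ((Literature.AlgebraicGeometry.Motives.baseChange k L).map i).left ≫
      pullback.snd Y.hom (Spec.map (CommRingCat.ofHom (algebraMap k L))) =
      pullback.snd X.hom (Spec.map (CommRingCat.ofHom (algebraMap k L))) := Over.w _
  have h2 : i.left ≫ Y.hom = X.hom := Over.w i
  rw [h1, h2]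
  exact (IsPullback.of_hasPullback X.hom _).flip

end BaseChangeSquare

section Fibre

variable (e : ℕ) {L : Type} [CommRing L] [Algebra (ParamRing e) L]

/-- `H̃` is natural in the coefficient ring. [cite: Hartshorne1977, II Ex. 3.11 (a)] -/
theorem map_branchForm {R S : Type} [CommRing R] [CommRing S] (f : R →+* S) (a : CIdx e → R) :
    MvPolynomial.map f (branchForm a) = branchForm (f ∘ a) := by
  simp only [branchForm, map_rename, map_mul, map_sub, map_X, map_cOfR, map_ψOfR]

/-- The open immersion of M1-1 as a morphism OVER `Spec A`. [cite: Hartshorne1977, II Example 3.2.6] -/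
theorem exists_chartEmbOver (he : 1 ≤ e) :
    ∃ F : specOver (ParamRing e) (DeckRing (univCoeffs e)) ⟶ cover e, IsOpenImmersion F.left ∧
      Set.range F.left = coverEmb e ⁻¹'
        (Proj.basicOpen (homogeneousSubmodule (Fin (2 + 2)) (ParamRing e)) (X 2 * branchForm (univCoeffs e)) : Set _) := by
  obtain ⟨f, hf, hover, -, hran⟩ := exists_chartEmb e he
  refine ⟨Over.homMk f hover, hf, ?_⟩
  change Set.range f = _
  rw [← Scheme.Hom.coe_opensRange, hran]
  rfl

/-- **M1-1, FIBREWISE (base-change form).** For every `A`-algebra `L` there is an open immersion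
`(deckChart X ⊗ specOver A L).left = Spec (DeckRing X) ×_A Spec L ⟶ (fiberSch e (algebraMap A L)).left = 𝒱 ×_A Spec L` over `Spec L`
with image `fiberEmb⁻¹ D₊(x₂·H̃_L)`. [cite: Liu2002, Rem. 3.1.20] [cite: Hartshorne1977, II Ex. 3.11 (a)] -/
theorem exists_chartEmb_baseChange (he : 1 ≤ e) :
    ∃ (g : ((Literature.AlgebraicGeometry.Motives.baseChange (ParamRing e) L).obj
          (specOver (ParamRing e) (DeckRing (univCoeffs e)))).left ⟶ (fiberSch e (algebraMap (ParamRing e) L)).left)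
      (_ : IsOpenImmersion g),
      g ≫ (fiberSch e (algebraMap (ParamRing e) L)).hom =
        ((Literature.AlgebraicGeometry.Motives.baseChange (ParamRing e) L).obj
          (specOver (ParamRing e) (DeckRing (univCoeffs e)))).hom ∧
      Set.range g = fiberEmb e (algebraMap (ParamRing e) L) ⁻¹'
        (Proj.basicOpen (homogeneousSubmodule (Fin (2 + 2)) L)
          (X 2 * branchForm (fun i => algebraMap (ParamRing e) L (X i))) : Set _) := by
  obtain ⟨F, hF, hran⟩ := exists_chartEmbOver e he
  have sq := isPullback_baseChange_map_left' (L := L) F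
  haveI : IsOpenImmersion ((Literature.AlgebraicGeometry.Motives.baseChange (ParamRing e) L).map F).left :=
    MorphismProperty.of_isPullback sq.flip hF
  refine ⟨((Literature.AlgebraicGeometry.Motives.baseChange (ParamRing e) L).map F).left, inferInstance,
    Over.w ((Literature.AlgebraicGeometry.Motives.baseChange (ParamRing e) L).map F), ?_⟩
  -- the image: `x ∈ range g ↔ fst x ∈ range F ↔ coverEmb (fst x) ∈ D₊ ↔ projMapOfHom (fiberEmb x) ∈ D₊ ↔ fiberEmb x ∈ D₊(map …)`
  have hsurj : Function.Surjective sq.isoPullback.hom := sq.isoPullback.hom.homeomorph.surjective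
  have hr : ∀ x : ↥(pullback (cover e).hom (Spec.map (CommRingCat.ofHom (algebraMap (ParamRing e) L)))),
      x ∈ Set.range ((Literature.AlgebraicGeometry.Motives.baseChange (ParamRing e) L).map F).left ↔
        pullback.fst (cover e).hom (Spec.map (CommRingCat.ofHom (algebraMap (ParamRing e) L))) x ∈
          Set.range F.left := by
    intro x
    rw [← Set.mem_preimage, ← Scheme.Pullback.range_fst, ← sq.isoPullback_hom_fst]
    simp only [Set.mem_range]
    constructor
    · rintro ⟨y, rfl⟩
      exact ⟨_, rfl⟩
    · rintro ⟨y, rfl⟩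
      obtain ⟨y', rfl⟩ := hsurj y
      exact ⟨y', rfl⟩
  have hmap : MvPolynomial.map (algebraMap (ParamRing e) L) (X 2 * branchForm (univCoeffs e)) =
      X 2 * branchForm (fun i => algebraMap (ParamRing e) L (X i)) := by
    rw [map_mul, map_X, map_branchForm]
    rfl
  ext x
  refine (hr x).trans ?_
  rw [hran, Set.mem_preimage, Set.mem_preimage, SetLike.mem_coe, SetLike.mem_coe, ← hmap,
    ← Scheme.Hom.comp_apply (pullback.fst (cover e).hom _) (coverEmb e), ← fiberEmb_comp_projMapOfHom,
    Scheme.Hom.comp_apply, Proj.mem_basicOpen, Proj.mem_basicOpen]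
  exact Iff.rfl

/-- **M1-1, FIBREWISE.** For every `A`-algebra `L` there is an open immersion `Spec (DeckRing X_L) ⟶ 𝒱 ×_A Spec L` over
`Spec L` (`X_L = algebraMap A L ∘ X`), with image `fiberEmb⁻¹ D₊(x₂·H̃_L)` — the deck chart of the fibre is an open piece of the
fibre (dense whenever non-empty and the fibre is irreducible, e.g. over `D(G_e)`). [cite: Liu2002, Rem. 3.1.20] [cite: Hartshorne1977, II Ex. 3.11 (a)] -/
theorem exists_chartEmb_fibre (he : 1 ≤ e) :
    ∃ (g : Spec (.of (DeckRing (algebraMap (ParamRing e) L ∘ univCoeffs e))) ⟶ (fiberSch e (algebraMap (ParamRing e) L)).left)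
      (_ : IsOpenImmersion g),
      Set.range g = fiberEmb e (algebraMap (ParamRing e) L) ⁻¹'
        (Proj.basicOpen (homogeneousSubmodule (Fin (2 + 2)) L)
          (X 2 * branchForm (fun i => algebraMap (ParamRing e) L (X i))) : Set _) := by
  obtain ⟨g, hg, -, hran⟩ := exists_chartEmb_baseChange e (L := L) he
  refine ⟨(deckChartTensorLeftIso L (univCoeffs e)).inv ≫ g, inferInstance, ?_⟩
  have hsurj : Function.Surjective (deckChartTensorLeftIso L (univCoeffs e)).inv :=
    (deckChartTensorLeftIso L (univCoeffs e)).inv.homeomorph.surjective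
  rw [← hran]
  ext y
  simp only [Set.mem_range]
  constructor
  · rintro ⟨x, rfl⟩
    exact ⟨_, rfl⟩
  · rintro ⟨x, rfl⟩
    obtain ⟨x', rfl⟩ := hsurj x
    exact ⟨x', rfl⟩

end Fibre

end Literature.AlgebraicGeometry.HodgeTheory.Q8Family

end
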